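import Mathlib
import HarnessLib
import Summits.CriticalPhenomena.Ising3DConformalLimit.Theses.HyperoctahedralRP
import Summits.CriticalPhenomena.Ising3DConformalLimit.Theorems.HyperoctahedralRPInversionUpgradeNormalisedLatticeRP
import Literature.Probability.Percolation.SiteConnectionTools

/-!
# Nine-mirror reflection positivity of the critical `ℤ³` Ising correlators
(route HyperoctahedralRP: the lattice input `CriticalCorrNineMirrorRP`, item stmt-CriticalPhenomena-1985,
proved here on the way to the milestone `TwoPointLimitIsotropic`, item stmt-CriticalPhenomena-1984)

For each of the nine site mirrors of `ℤ³` through the origin — the coordinate planes `x_i = 0`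
(`θ` negates `x_i`, level `ℓ = x_i`), the diagonal planes `x_i = x_j` (`θ` swaps, `ℓ = x_i - x_j`)
and the anti-diagonal planes `x_i = -x_j` (`θ : x_i ↦ -x_j, x_j ↦ -x_i`, `ℓ = x_i + x_j`) — and
finitely many lattice configurations `x^a` inside `{ℓ > 0}` with real coefficients `c_a`,
`Σ_{ab} c_a c_b ⟨∏ σ_{θ x^a ++ x^b}⟩_{β_c} ≥ 0` (`criticalCorrNineMirrorRP_proof`, literally the route
decl `CriticalCorrNineMirrorRP`).

Proof. `sum_sum_mul_isingExpect_free_levelMirror_nonneg`: the level form of finite-volume free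
reflection positivity through sites — an involutive graph automorphism `θ` of `ℤ^d` with an integer
level `ℓ`, `ℓ ∘ θ = -ℓ`, `θ = id` on `{ℓ = 0}`, `|ℓ x - ℓ y| ≤ 1` along edges, puts the half
`P = {ℓ ≥ 0}` in the FILS site position (`ℤ^d = P ∪ θP`, `θ = id` on `P ∩ θP`, every edge inside `P`
or inside `θP`), so the tree theorem `isingExpect_free_reflect_mul_self_nonneg` (FILS 1978 §2;
Friedli–Velenik 2017 Lemma 10.8) applies to `F = Σ_a c_a ∏ σ_{x^a_i}` on every `θ`-stable volume;
`criticalCorr_levelMirror_rp` passes to `β = β_c`, `h = 0`, `L → ∞` on the centred boxes through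
`criticalCorr_wellDefined_holds` (which rests on `m*(β_c) = 0`, Aizenman–Duminil-Copin–Sidoravicius
2015). The three mirror families are checked to satisfy the hypotheses (the diagonal ones are the
signed permutations `(swap i j, ±)`, graph automorphisms preserving the boxes by the tree's
`zdGraph_adj_signedPerm`, `signedPerm_mem_box_iff`). The coordinate case re-derives the landed
`stub_latticeRP` (`…InversionUpgradeNormalisedLatticeRP`), whose helper lemmas are reused.

References: J. Fröhlich, R. Israel, E. H. Lieb, B. Simon, Comm. Math. Phys. 62 (1978) 1–34, §2–3
(Thm. 3.1: RP in planes through sites, including diagonal planes); S. Friedli, Y. Velenik,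
*Statistical Mechanics of Lattice Systems* (CUP 2017), Lemma 10.8. No definitions are introduced.
-/

noncomputable section

namespace Summit.CriticalPhenomena.Ising3DConformalLimit.HyperoctahedralRPNineMirror

open Filter MeasureTheory
open scoped Topology
open Literature.Probability.LatticeModels Literature.Probability.Percolation
open Summit.CriticalPhenomena.Ising3DConformalLimit.Cruxes.InversionUpgradeNormalised.FreeEndpointGaussianClosure

variable {d : ℕ}

/-! ### Reflection positivity through a lattice mirror with an integer level -/

/-- **Finite-volume free reflection positivity through a site mirror, level form.** Let `θ` be an
involutive automorphism of the nearest-neighbour graph `ℤ^d` and `ℓ : ℤ^d → ℤ` a level with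
`ℓ ∘ θ = -ℓ`, `θ = id` on `{ℓ = 0}` and `|ℓ x - ℓ y| ≤ 1` along edges (so every edge lies in
`{ℓ ≥ 0}` or in `{ℓ ≤ 0}`). For a `θ`-stable finite volume, real `β, h`, configurations `z^a` in the
closed half `{ℓ ≥ 0}` and real coefficients `c_a`,
`0 ≤ Σ_{a,b} c_a c_b ⟨∏ σ_{θ z^a ++ z^b}⟩^∅_{Λ;β,h}` (FILS 1978 §2, RP through sites;
Friedli–Velenik 2017 Lemma 10.8 — the tree theorem `isingExpect_free_reflect_mul_self_nonneg`).
[cite: FrohlichEtAl1978, §2] -/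
theorem sum_sum_mul_isingExpect_free_levelMirror_nonneg (θ : Site d → Site d)
    (hθ : Function.Involutive θ) (hθG : ∀ x y, (zdGraph d).Adj x y → (zdGraph d).Adj (θ x) (θ y))
    (ℓ : Site d → ℤ) (hℓθ : ∀ x, ℓ (θ x) = -ℓ x) (hfix : ∀ x, ℓ x = 0 → θ x = x)
    (hadj : ∀ x y, (zdGraph d).Adj x y → ℓ x ≤ ℓ y + 1 ∧ ℓ y ≤ ℓ x + 1)
    {Λ : Finset (Site d)} (hΛ : ∀ x, x ∈ Λ ↔ θ x ∈ Λ) (β h : ℝ) {m : ℕ} (k : Fin m → ℕ)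
    (z : (a : Fin m) → Fin (k a) → Site d) (c : Fin m → ℝ) (hz : ∀ a i, 0 ≤ ℓ (z a i)) :
    0 ≤ ∑ a, ∑ b, c a * c b * isingExpect (zdGraph d) Λ β h .free
      (spinMonomial (Fin.append (fun i => θ (z a i)) (z b))) := by
  classical
  let θe : Site d ≃ Site d := hθ.toPerm _
  have hθe : ∀ x, θe x = θ x := fun x => rfl
  let P : Set (Site d) := {x | 0 ≤ ℓ x}
  have hmemP : ∀ x, x ∈ P ↔ 0 ≤ ℓ x := fun x => Iff.rfl
  have hmemθP : ∀ x, θe x ∈ P ↔ 0 ≤ -ℓ x := fun x => by rw [hmemP, hθe, hℓθ]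
  have hθG' : ∀ x y, (zdGraph d).Adj x y → (zdGraph d).Adj (θe x) (θe y) := hθG
  have hΛ' : ∀ x, x ∈ Λ ↔ θe x ∈ Λ := hΛ
  have H1 : ∀ x, x ∈ P ∨ θe x ∈ P := fun x => by
    rw [hmemP, hmemθP]
    omega
  have H2 : ∀ x ∈ P, θe x ∈ P → θe x = x := fun x hx hθx => by
    rw [hmemP] at hx
    rw [hmemθP] at hθx
    exact hfix x (by omega)
  have H3 : ∀ x y, (zdGraph d).Adj x y → (x ∈ P ∧ y ∈ P) ∨ (θe x ∈ P ∧ θe y ∈ P) :=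
    fun x y hxy => by
      have h := hadj x y hxy
      rw [hmemP, hmemP, hmemθP, hmemθP]
      omega
  have hFm : Measurable fun σ : SpinConfig (Site d) => ∑ a, c a * spinMonomial (z a) σ :=
    Finset.measurable_sum _ fun a _ => (measurable_spinMonomial (z a)).const_mul (c a)
  have hFP : DependsOn (fun σ : SpinConfig (Site d) => ∑ a, c a * spinMonomial (z a) σ) P := by
    intro σ σ' hσ
    refine Finset.sum_congr rfl fun a _ => ?_
    simp only [spinMonomial, spinAt]
    congr 1
    exact Finset.prod_congr rfl fun i _ => by rw [hσ (z a i) ((hmemP _).2 (hz a i))]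
  have hFb : ∃ C, ∀ σ : SpinConfig (Site d), |∑ a, c a * spinMonomial (z a) σ| ≤ C := by
    refine ⟨∑ a, |c a|, fun σ => (Finset.abs_sum_le_sum_abs _ _).trans (Finset.sum_le_sum
      fun a _ => ?_)⟩
    obtain ⟨A, hA⟩ := exists_spinMonomial_eq_spinProduct (z a)
    rw [abs_mul, hA]
    exact mul_le_of_le_one_right (abs_nonneg _) (abs_spinProduct_le_one A σ)
  have hpos := isingExpect_free_reflect_mul_self_nonneg (zdGraph d) θe hθ hθG'
    hΛ' H1 H2 H3 β h hFm hFP hFb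
  have hexp : (fun σ : SpinConfig (Site d) => (∑ a, c a * spinMonomial (z a) (configReflect θe σ)) *
      ∑ a, c a * spinMonomial (z a) σ) = fun σ => ∑ a, ∑ b, c a * c b *
        spinMonomial (Fin.append (fun i => θ (z a i)) (z b)) σ := by
    funext σ
    rw [Fintype.sum_mul_sum]
    refine Finset.sum_congr rfl fun a _ => Finset.sum_congr rfl fun b _ => ?_
    have hrefl : spinMonomial (z a) (configReflect θe σ) =
        spinMonomial (fun i => θ (z a i)) σ := rfl
    rw [spinMonomial_append_apply, hrefl]
    ring
  rw [hexp, isingExpect_sum_sum_mul_spinMonomial Λ β h .free (fun a b => c a * c b)] at hpos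
  exact hpos

/-- **Infinite-volume critical version on `ℤ³`.** Under the same hypotheses on `(θ, ℓ)`, with the
centred boxes `θ`-stable: `0 ≤ Σ_{a,b} c_a c_b ⟨∏ σ_{θ z^a ++ z^b}⟩_{β_c}` for configurations in the
closed half `{ℓ ≥ 0}` — the finite-volume inequality on `box 3 L` and the box limit
`⟨∏ σ⟩^∅_{box 3 L; β_c, 0} → criticalCorr 3` (`criticalCorr_wellDefined_holds`).
[cite: FrohlichEtAl1978, §3 Thm 3.1] -/
theorem criticalCorr_levelMirror_rp (θ : Site 3 → Site 3)
    (hθ : Function.Involutive θ) (hθG : ∀ x y, (zdGraph 3).Adj x y → (zdGraph 3).Adj (θ x) (θ y))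
    (ℓ : Site 3 → ℤ) (hℓθ : ∀ x, ℓ (θ x) = -ℓ x) (hfix : ∀ x, ℓ x = 0 → θ x = x)
    (hadj : ∀ x y, (zdGraph 3).Adj x y → ℓ x ≤ ℓ y + 1 ∧ ℓ y ≤ ℓ x + 1)
    (hbox : ∀ (L : ℕ) (x : Site 3), x ∈ box 3 L ↔ θ x ∈ box 3 L)
    (m : ℕ) (k : Fin m → ℕ) (z : (a : Fin m) → Fin (k a) → Site 3) (c : Fin m → ℝ)
    (hz : ∀ a i, 0 ≤ ℓ (z a i)) :
    0 ≤ ∑ a, ∑ b, c a * c b *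
      criticalCorr 3 (k a + k b) (Fin.append (fun i => θ (z a i)) (z b)) := by
  have hmem : (BoundaryCondition.free : BoundaryCondition (Site 3)) ∈
      ({.free, .plus, .minus} : Set (BoundaryCondition (Site 3))) := by simp
  have hT : Tendsto (fun L : ℕ => ∑ a, ∑ b, c a * c b *
      isingExpect (zdGraph 3) (box 3 L) (criticalBeta 3) 0 .free
        (spinMonomial (Fin.append (fun i => θ (z a i)) (z b))))
      atTop (𝓝 (∑ a, ∑ b, c a * c b * criticalCorr 3 (k a + k b)
        (Fin.append (fun i => θ (z a i)) (z b)))) :=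
    tendsto_finsetSum _ fun a _ => tendsto_finsetSum _ fun b _ =>
      (criticalCorr_wellDefined_holds (d := 3) (by norm_num) (k a + k b) _ .free hmem).const_mul _
  exact ge_of_tendsto' hT fun L => sum_sum_mul_isingExpect_free_levelMirror_nonneg θ hθ hθG ℓ hℓθ
    hfix hadj (hbox L) (criticalBeta 3) 0 k z c hz

/-! ### The diagonal and anti-diagonal mirrors of `ℤ^d` -/

/-- The diagonal mirror (swap of coordinates `i`, `j`) is the signed permutation `(swap i j, +)`.
[folklore] -/
theorem swapMirror_eq_signedPerm (i j : Fin d) :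
    (fun x : Site d => x ∘ Equiv.swap i j) = ⇑(Site.signedPerm (Equiv.swap i j) 1) := by
  funext x l
  simp [Site.signedPerm_apply, Equiv.symm_swap]

/-- The anti-diagonal mirror `x_i ↦ -x_j`, `x_j ↦ -x_i` is the signed permutation
`(swap i j, ε)` with `ε = -1` on `{i, j}`. [folklore] -/
theorem antiMirror_eq_signedPerm {i j : Fin d} (hij : i ≠ j) :
    (fun x : Site d => Function.update (Function.update x i (-x j)) j (-x i)) =
      ⇑(Site.signedPerm (Equiv.swap i j) (fun l => if l = i ∨ l = j then -1 else 1)) := by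
  funext x l
  rw [Site.signedPerm_apply, Equiv.symm_swap]
  by_cases hlj : l = j
  · subst hlj
    simp [Equiv.swap_apply_right]
  · by_cases hli : l = i
    · subst hli
      simp [Function.update_of_ne hlj, Equiv.swap_apply_left]
    · simp [hli, hlj, Equiv.swap_apply_of_ne_of_ne hli hlj]

/-- The diagonal mirror is an involution. [folklore] -/
theorem swapMirror_involutive (i j : Fin d) :
    Function.Involutive (fun x : Site d => x ∘ Equiv.swap i j) := by
  intro x
  funext l
  simp [Equiv.swap_apply_self]

/-- The anti-diagonal mirror is an involution. [folklore] -/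
theorem antiMirror_involutive {i j : Fin d} (hij : i ≠ j) :
    Function.Involutive (fun x : Site d => Function.update (Function.update x i (-x j)) j (-x i)) := by
  intro x
  funext l
  by_cases hlj : l = j
  · subst hlj
    simp [Function.update_of_ne hij]
  · by_cases hli : l = i
    · subst hli
      simp [Function.update_of_ne hlj]
    · simp [Function.update_of_ne hlj, Function.update_of_ne hli]

/-- Along an edge of `ℤ^d` a difference of two coordinates changes by at most one. [folklore] -/
theorem sub_le_add_one_of_adj (i j : Fin d) {x y : Site d} (h : (zdGraph d).Adj x y) :
    x i - x j ≤ y i - y j + 1 ∧ y i - y j ≤ x i - x j + 1 := by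
  rw [zdGraph_adj_iff] at h
  obtain ⟨l, hl⟩ := h
  have hi : (Pi.single l (1 : ℤ) : Site d) i = if i = l then 1 else 0 := by
    by_cases h : i = l
    · subst h; simp
    · simp [h]
  have hj : (Pi.single l (1 : ℤ) : Site d) j = if j = l then 1 else 0 := by
    by_cases h : j = l
    · subst h; simp
    · simp [h]
  rcases hl with rfl | rfl
  · simp only [Pi.add_apply, hi, hj]
    split_ifs <;> omega
  · simp only [Pi.add_apply, hi, hj]
    split_ifs <;> omega

/-- Along an edge of `ℤ^d` a sum of two distinct coordinates changes by at most one. [folklore] -/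
theorem add_le_add_one_of_adj {i j : Fin d} (hij : i ≠ j) {x y : Site d} (h : (zdGraph d).Adj x y) :
    x i + x j ≤ y i + y j + 1 ∧ y i + y j ≤ x i + x j + 1 := by
  rw [zdGraph_adj_iff] at h
  obtain ⟨l, hl⟩ := h
  have hi : (Pi.single l (1 : ℤ) : Site d) i = if i = l then 1 else 0 := by
    by_cases h : i = l
    · subst h; simp
    · simp [h]
  have hj : (Pi.single l (1 : ℤ) : Site d) j = if j = l then 1 else 0 := by
    by_cases h : j = l
    · subst h; simp
    · simp [h]
  rcases hl with rfl | rfl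
  · simp only [Pi.add_apply, hi, hj]
    split_ifs <;> omega
  · simp only [Pi.add_apply, hi, hj]
    split_ifs <;> omega

/-! ### The nine-mirror reflection positivity -/

open Summit.CriticalPhenomena.Ising3DConformalLimit.Theses.HyperoctahedralRP in
/-- **`CriticalCorrNineMirrorRP`** (item stmt-CriticalPhenomena-1985): for each of the nine site
mirrors of `ℤ³` through the origin — coordinate plane `x_i = 0`, diagonal plane `x_i = x_j`,
anti-diagonal plane `x_i = -x_j` — finitely many lattice configurations strictly inside the
positive side and real coefficients, `Σ_{ab} c_a c_b ⟨∏ σ_{θ x^a ++ x^b}⟩_{β_c} ≥ 0`. Each mirror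
is an involutive automorphism of the nearest-neighbour graph mapping the centred boxes to
themselves, with an integer level changing by at most one along edges; finite-volume free
reflection positivity through sites (FILS 1978 §2, `isingExpect_free_reflect_mul_self_nonneg`)
and the box limit at `β_c` (`criticalCorr_wellDefined_holds`, resting on `m*(β_c) = 0`, ADS 2015)
give the claim (even for the closed half). [cite: FrohlichEtAl1978, §3 Thm 3.1] -/
theorem criticalCorrNineMirrorRP_proof : CriticalCorrNineMirrorRP := by
  intro θ ℓ hθℓ m k x c hx
  obtain ⟨i, j, hij, ⟨rfl, rfl⟩ | ⟨rfl, rfl⟩ | ⟨rfl, rfl⟩⟩ := hθℓ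
  · -- coordinate mirror `x_i ↦ -x_i`, level `x_i`
    refine criticalCorr_levelMirror_rp _ (mirror_involutive i) (fun x y h => mirror_adj i h)
      (fun x => x i) (fun x => by simp) (fun x hx0 => ?_) (fun x y h => apply_le_add_one_of_adj i h)
      (fun L x => mem_box_iff_mirror_mem_box i L x) m k x c (fun a l => (hx a l).le)
    have hx0' : x i = 0 := hx0
    rw [hx0', neg_zero, ← hx0', Function.update_eq_self]
  · -- diagonal mirror (swap), level `x_i - x_j`
    refine criticalCorr_levelMirror_rp _ (swapMirror_involutive i j) (fun x y h => ?_)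
      (fun x => x i - x j) (fun x => ?_) (fun x hx0 => ?_) (fun x y h => sub_le_add_one_of_adj i j h)
      (fun L x => ?_) m k x c (fun a l => (hx a l).le)
    · have h' := zdGraph_adj_signedPerm (Equiv.swap i j) 1 h
      rw [← swapMirror_eq_signedPerm] at h'
      exact h'
    · simp [Equiv.swap_apply_left, Equiv.swap_apply_right]
    · have hx0' : x i - x j = 0 := hx0
      funext l
      simp only [Function.comp_apply]
      by_cases hli : l = i
      · subst hli; rw [Equiv.swap_apply_left]; omega
      · by_cases hlj : l = j
        · subst hlj; rw [Equiv.swap_apply_right]; omega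
        · rw [Equiv.swap_apply_of_ne_of_ne hli hlj]
    · have h' := (signedPerm_mem_box_iff (Equiv.swap i j) 1 (n := L) (x := x)).symm
      rw [← swapMirror_eq_signedPerm] at h'
      exact h'
  · -- anti-diagonal mirror, level `x_i + x_j`
    refine criticalCorr_levelMirror_rp _ (antiMirror_involutive hij) (fun x y h => ?_)
      (fun x => x i + x j) (fun x => ?_) (fun x hx0 => ?_) (fun x y h => add_le_add_one_of_adj hij h)
      (fun L x => ?_) m k x c (fun a l => (hx a l).le)
    · have h' := zdGraph_adj_signedPerm (Equiv.swap i j) (fun l => if l = i ∨ l = j then -1 else 1) h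
      rw [← antiMirror_eq_signedPerm hij] at h'
      exact h'
    · simp [Function.update_of_ne hij, add_comm]
    · have hx0' : x i + x j = 0 := hx0
      funext l
      by_cases hlj : l = j
      · subst hlj
        rw [Function.update_self]
        omega
      · by_cases hli : l = i
        · subst hli
          rw [Function.update_of_ne hlj, Function.update_self]
          omega
        · rw [Function.update_of_ne hlj, Function.update_of_ne hli]
    · have h' := (signedPerm_mem_box_iff (Equiv.swap i j)
        (fun l => if l = i ∨ l = j then -1 else 1) (n := L) (x := x)).symm
      rw [← antiMirror_eq_signedPerm hij] at h'
      exact h'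

end Summit.CriticalPhenomena.Ising3DConformalLimit.HyperoctahedralRPNineMirror

end
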